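import Summits.CriticalPhenomena.PercolationContinuityZ3.Theorems.Transplant.SubgraphLocMod
import Mathlib.Combinatorics.SimpleGraph.Walk.Decomp
import HarnessLib

/-!
# Routes from cycle data, I: walk lemmas, cycle kits, the case `u ∈ M`

builds on p205010 (kernel theorem, internal audit signed; external expert review pending) — nothing in this file uses p205010.
Lane `prim-bschramm`, seat `prim-bschramm-p4` gen 10 (PART C3, tier 2′ of `P4-GENERAL.md`).  Helper file
(`--supports stmt-CriticalPhenomena-4575 --as helper`).  Pure graph theory; sequel of `SubgraphLocMod`.

A `SubLoc.CycleKit H E' x y` is the geometry the Cayley-graph cylinders supply for an edge `{x, y}` of the subgraph: a path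
`x —A→ p —M→ q —B→ y` closing up with the edge `{y, x}` to a cycle, where every edge of `M` is an ENHANCEMENT edge (`∈ E'`), `M` is
non-trivial, and `A`, `B` ("columns" of `x` and `y`) are paths, pairwise meeting only at the junctions.  This file: the `takeUntil`/`dropUntil`
bookkeeping on paths (§1), the kit, its zone `Z` and its mirror image (§2), and the route (`SubLoc.RouteData`) when the first cycle vertex
seen from the root lies on `M` away from the columns (§3).  The column cases and the assembly are the sequel file.
-/

namespace Summit.CriticalPhenomena.PercolationContinuityZ3.Theorems.Transplant

namespace SubLoc

open SimpleGraph Walk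

variable {V : Type} {H : SimpleGraph V}

/-! ## §1 Walk lemmas -/

/-- A walk between distinct vertices starts with an edge. [folklore] -/
theorem exists_eq_cons {a b : V} (P : H.Walk a b) (h : a ≠ b) :
    ∃ c, ∃ hac : H.Adj a c, ∃ P' : H.Walk c b, P = Walk.cons hac P' := by
  cases P with
  | nil => exact absurd rfl h
  | cons hac P' => exact ⟨_, hac, P', rfl⟩

section Dec

variable [DecidableEq V]

/-- Every vertex of a walk is before or after a given vertex. [folklore] -/
theorem mem_takeUntil_or_dropUntil {a b u w : V} (P : H.Walk a b) (hu : u ∈ P.support) (hw : w ∈ P.support) :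
    w ∈ (P.takeUntil u hu).support ∨ w ∈ (P.dropUntil u hu).support := by
  rw [← take_spec P hu, Walk.mem_support_append_iff] at hw
  exact hw

/-- On a path the prefix and the suffix at `u` meet only at `u`. [folklore] -/
theorem eq_of_mem_takeUntil_of_mem_dropUntil {a b u w : V} {P : H.Walk a b} (hP : P.IsPath) (hu : u ∈ P.support)
    (h1 : w ∈ (P.takeUntil u hu).support) (h2 : w ∈ (P.dropUntil u hu).support) : w = u := by
  by_contra hne
  have hnd : ((P.takeUntil u hu).append (P.dropUntil u hu)).support.Nodup := by rw [take_spec]; exact hP.support_nodup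
  rw [support_append] at hnd
  have h2' : w ∈ (P.dropUntil u hu).support.tail := by
    rw [← cons_tail_support] at h2
    exact (List.mem_cons.1 h2).resolve_left hne
  exact List.disjoint_of_nodup_append hnd h1 h2'

/-- On a path the endpoint is not in a proper prefix. [folklore] -/
theorem end_not_mem_takeUntil {a b v : V} {P : H.Walk a b} (hP : P.IsPath) (hv : v ∈ P.support) (hne : v ≠ b) :
    b ∉ (P.takeUntil v hv).support :=
  fun h => hne (eq_of_mem_takeUntil_of_mem_dropUntil hP hv h (end_mem_support _)).symm

/-- On a path the start is not in a proper suffix. [folklore] -/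
theorem start_not_mem_dropUntil {a b v : V} {P : H.Walk a b} (hP : P.IsPath) (hv : v ∈ P.support) (hne : v ≠ a) :
    a ∉ (P.dropUntil v hv).support :=
  fun h => hne (eq_of_mem_takeUntil_of_mem_dropUntil hP hv (start_mem_support _) h).symm

/-- `takeUntil` past a prefix that does not contain the target. [folklore] -/
theorem takeUntil_append_of_notMem_left {a u b v : V} (T : H.Walk a u) (D : H.Walk u b) (hv : v ∈ D.support)
    (hvT : v ∉ T.support) (h : v ∈ (T.append D).support) :
    (T.append D).takeUntil v h = T.append (D.takeUntil v hv) := by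
  induction T with
  | nil => rfl
  | cons r T' ih =>
    rw [support_cons, List.mem_cons, not_or] at hvT
    have hmem : v ∈ (T'.append D).support := (Walk.mem_support_append_iff _ _).2 (Or.inr hv)
    calc ((cons r T').append D).takeUntil v h = (cons r (T'.append D)).takeUntil v (List.mem_of_mem_tail hmem) := rfl
      _ = cons r ((T'.append D).takeUntil v hmem) := takeUntil_cons hmem (Ne.symm hvT.1) r
      _ = cons r (T'.append (D.takeUntil v hv)) := by rw [ih D hv hvT.2 hmem]
      _ = (cons r T').append (D.takeUntil v hv) := rfl

/-- Along a walk two vertices are comparable: one lies in the prefix of the other. [folklore] -/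
theorem mem_takeUntil_total {a b u v : V} (P : H.Walk a b) (hu : u ∈ P.support) (hv : v ∈ P.support) :
    v ∈ (P.takeUntil u hu).support ∨ u ∈ (P.takeUntil v hv).support := by
  by_cases hvT : v ∈ (P.takeUntil u hu).support
  · exact Or.inl hvT
  · right
    have hvD : v ∈ (P.dropUntil u hu).support := (mem_takeUntil_or_dropUntil P hu hv).resolve_left hvT
    have hmem : v ∈ ((P.takeUntil u hu).append (P.dropUntil u hu)).support := by rw [take_spec]; exact hv
    have key := takeUntil_append_of_notMem_left (P.takeUntil u hu) (P.dropUntil u hu) hvD hvT hmem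
    have gen : ∀ (Q : H.Walk a b) (h' : v ∈ Q.support), Q = P →
        u ∈ (Q.takeUntil v h').support → u ∈ (P.takeUntil v hv).support := by
      intro Q h' hQ; subst hQ; exact id
    refine gen _ hmem (take_spec P hu) ?_
    rw [key, Walk.mem_support_append_iff]
    exact Or.inl (end_mem_support _)

/-- On a path, a prefix ending before `v` does not meet the suffix from `v`. [folklore] -/
theorem takeUntil_dropUntil_disjoint {a b u v : V} {P : H.Walk a b} (hP : P.IsPath) (hu : u ∈ P.support) (hv : v ∈ P.support)
    (hvT : v ∉ (P.takeUntil u hu).support) {w : V} (h1 : w ∈ (P.takeUntil u hu).support)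
    (h2 : w ∈ (P.dropUntil v hv).support) : False := by
  have huv : u ∈ (P.takeUntil v hv).support := (mem_takeUntil_total P hu hv).resolve_left hvT
  have hw1 : w ∈ (P.takeUntil v hv).support := by
    rw [← takeUntil_takeUntil P hv huv] at h1
    exact support_takeUntil_subset_support _ _ h1
  have hwv := eq_of_mem_takeUntil_of_mem_dropUntil hP hv hw1 h2
  subst hwv
  exact hvT h1

end Dec

/-! ## §2 Cycle kits -/

/-- **CYCLE KIT** for the ordered pair `(x, y)` (an edge `{x, y}` of the subgraph, `x` on the root's side): paths `x —A→ p`, `p —M→ q`,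
`q —B→ y`, the closing edge `{y, x}`, `M` non-trivial with all edges in the enhancement class `E'`, the three paths meeting only at the
junctions, and `x ≠ p`, `q ≠ y`. [cite: BalisterBollobasRiordan2014, §"bond percolation" p. 13] -/
structure CycleKit (H : SimpleGraph V) (E' : Set (Sym2 V)) (x y : V) where
  /-- top of the column of `x` -/
  p : V
  /-- top of the column of `y` -/
  q : V
  /-- the column of `x` -/
  A : H.Walk x p
  /-- the enhancement run -/
  M : H.Walk p q
  /-- the column of `y`, traversed downwards -/
  B : H.Walk q y
  /-- `A` is a path -/
  hA : A.IsPath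
  /-- `M` is a path -/
  hM : M.IsPath
  /-- `B` is a path -/
  hB : B.IsPath
  /-- `M` is non-trivial -/
  hpq : p ≠ q
  /-- `A` is non-trivial -/
  hxp : x ≠ p
  /-- `B` is non-trivial -/
  hqy : q ≠ y
  /-- `A` and `M` meet only at `p` -/
  hAM : ∀ w, w ∈ A.support → w ∈ M.support → w = p
  /-- `M` and `B` meet only at `q` -/
  hMB : ∀ w, w ∈ M.support → w ∈ B.support → w = q
  /-- `A` and `B` are disjoint -/
  hAB : ∀ w, w ∈ A.support → w ∈ B.support → False
  /-- every edge of `M` is an enhancement edge -/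
  hME : ∀ d ∈ M.edges, d ∈ E'
  /-- the closing edge -/
  hyx : H.Adj y x

namespace CycleKit

variable {E' : Set (Sym2 V)} {x y : V} (K : CycleKit H E' x y)

/-- The zone: all vertices of the cycle. [folklore] -/
def Z : Set V := {w | w ∈ K.A.support ∨ w ∈ K.M.support ∨ w ∈ K.B.support}

/-- **The mirrored kit** (exchange the roles of `x` and `y`). [folklore] -/
def mirror : CycleKit H E' y x where
  p := K.q
  q := K.p
  A := K.B.reverse
  M := K.M.reverse
  B := K.A.reverse
  hA := K.hB.reverse
  hM := K.hM.reverse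
  hB := K.hA.reverse
  hpq := K.hpq.symm
  hxp := K.hqy.symm
  hqy := K.hxp.symm
  hAM := fun w h1 h2 => K.hMB w (by simpa using h2) (by simpa using h1)
  hMB := fun w h1 h2 => K.hAM w (by simpa using h2) (by simpa using h1)
  hAB := fun w h1 h2 => K.hAB w (by simpa using h2) (by simpa using h1)
  hME := fun d hd => K.hME d (by simpa using hd)
  hyx := K.hyx.symm

/-- The mirrored kit has the same zone. [folklore] -/
theorem mirror_Z : K.mirror.Z = K.Z := by
  ext w
  simp only [Z, mirror, support_reverse, List.mem_reverse, Set.mem_setOf_eq]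
  tauto

/-- `x ∈ Z`. [folklore] -/
theorem x_mem_Z : x ∈ K.Z := Or.inl K.A.start_mem_support

/-- `y ∈ Z`. [folklore] -/
theorem y_mem_Z : y ∈ K.Z := Or.inr (Or.inr K.B.end_mem_support)

/-- The data "`t` is a legitimate end of a route": `t ∉ Ω`, or an `ωe`-open walk from `t` out of `Ω` meeting `Z` only at `t`. [folklore] -/
def Exit (ωe : Set (Sym2 V)) (Ω : Set V) (t : V) : Prop :=
  t ∉ Ω ∨ ∃ q', q' ∉ Ω ∧ ∃ ρ : (og H ωe).Walk t q', ∀ w ∈ ρ.support, w ∈ K.Z → w = t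

/-- `Exit` for the mirrored kit. [folklore] -/
theorem mirror_exit {ωe : Set (Sym2 V)} {Ω : Set V} {t : V} (h : K.Exit ωe Ω t) : K.mirror.Exit ωe Ω t := by
  rcases h with h | ⟨q', hq', ρ, hρ⟩
  · exact Or.inl h
  · exact Or.inr ⟨q', hq', ρ, fun w hw hZ => hρ w hw (by rwa [K.mirror_Z] at hZ)⟩

/-! ## §3 The route when `u` lies on `M` away from the columns -/

section Dec

variable [DecidableEq V]

/-- **Case `u ∈ M`, `u ∉ A ∪ B`.**  The route starts with the enhancement edge of `M` at `u` (towards `q`), runs through the rest of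
`M`, `B`, the closing edge and `A`, and — if the target is not met there — back into `M` from `p`.
[cite: BalisterBollobasRiordan2014, §"bond percolation" p. 13] -/
theorem routeData_of_mem_M {ωe : Set (Sym2 V)} {Ω : Set V} {o u v₀ : V}
    (huM : u ∈ K.M.support) (huA : u ∉ K.A.support) (huB : u ∉ K.B.support) (huΩ : u ∈ Ω)
    (π : (og H ωe).Walk o u) (hπ : ∀ w ∈ π.support, w ∈ K.Z → w = u)
    (hv₀Z : v₀ ∈ K.Z) (hv₀u : v₀ ≠ u) (hv₀ : K.Exit ωe Ω v₀) :
    ∃ D : RouteData H ωe Ω K.Z o, s(D.a, D.b) ∈ E' := by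
  have huq : u ≠ K.q := fun h => huB (h ▸ K.B.start_mem_support)
  -- the edge of `M` at `u` towards `q`
  obtain ⟨m', hum', M₂, hM₂⟩ := exists_eq_cons (K.M.dropUntil u huM) huq
  have hMd : (K.M.dropUntil u huM).IsPath := K.hM.dropUntil huM
  rw [hM₂, cons_isPath_iff] at hMd
  have hM₂sub : ∀ w ∈ M₂.support, w ∈ K.M.support := fun w hw =>
    support_dropUntil_subset_support K.M huM (by rw [hM₂, support_cons]; exact List.mem_cons_of_mem _ hw)
  have hf : s(u, m') ∈ E' := K.hME _ (edges_dropUntil_subset_edges K.M huM (by rw [hM₂, edges_cons]; exact List.mem_cons_self))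
  -- the forward walk `m' —M₂→ q —B→ y —e→ x —A→ p`
  set W : H.Walk m' K.p := M₂.append (K.B.append (Walk.cons K.hyx K.A)) with hW
  have hWsub : ∀ w ∈ W.support, w ∈ K.Z := by
    intro w hw
    simp only [hW, mem_support_append_iff, support_cons, List.mem_cons] at hw
    rcases hw with hw | hw | hw | hw
    · exact Or.inr (Or.inl (hM₂sub w hw))
    · exact Or.inr (Or.inr hw)
    · exact hw ▸ K.y_mem_Z
    · exact Or.inl hw
  have huW : u ∉ W.support := by
    intro hw
    simp only [hW, mem_support_append_iff, support_cons, List.mem_cons] at hw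
    rcases hw with hw | hw | hw | hw
    · exact hMd.2 hw
    · exact huB hw
    · exact huB (hw ▸ K.B.end_mem_support)
    · exact huA hw
  -- the route data, given the second half
  have build : ∀ (v : V) (R₂ : H.Walk m' v), (∀ w ∈ R₂.support, w ∈ K.Z) → u ∉ R₂.support → K.Exit ωe Ω v →
      ∃ D : RouteData H ωe Ω K.Z o, s(D.a, D.b) ∈ E' := by
    intro v R₂ hR₂ huR₂ hv
    refine ⟨⟨u, u, m', v, Walk.nil, hum', R₂, ?_, ?_, hR₂, ?_, π, hπ, hv⟩, hf⟩
    · intro w hw hw2; rw [support_nil, List.mem_singleton] at hw; subst hw; exact huR₂ hw2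
    · intro w hw; rw [support_nil, List.mem_singleton] at hw; subst hw; exact Or.inr (Or.inl huM)
    · intro w hw; rw [support_nil, List.mem_singleton] at hw; subst hw; exact huΩ
  by_cases hα : ∃ t ∈ W.support, t = v₀ ∨ t ∉ Ω
  · -- a target on `W`
    obtain ⟨t, htW, ht⟩ := hα
    refine build t (W.takeUntil t htW) (fun w hw => hWsub w (support_takeUntil_subset_support _ _ hw))
      (fun hw => huW (support_takeUntil_subset_support _ _ hw)) ?_
    rcases ht with rfl | ht
    · exact hv₀
    · exact Or.inl ht
  · -- no target on `W`: `v₀` lies on `M` before `u`; continue from `p` into `M`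
    push Not at hα
    have hv₀W : v₀ ∉ W.support := fun h => (hα v₀ h).1 rfl
    have hv₀M : v₀ ∈ K.M.support := by
      rcases hv₀Z with h | h | h
      · exact absurd (by simp [hW, mem_support_append_iff, h]) hv₀W
      · exact h
      · exact absurd (by simp [hW, mem_support_append_iff, h]) hv₀W
    have hv₀T : v₀ ∈ (K.M.takeUntil u huM).support := by
      rcases mem_takeUntil_or_dropUntil K.M huM hv₀M with h | h
      · exact h
      · rw [hM₂, support_cons, List.mem_cons] at h
        rcases h with h | h
        · exact absurd h hv₀u
        · exact absurd (by simp [hW, mem_support_append_iff, h]) hv₀W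
    have huT : u ∉ (K.M.takeUntil v₀ hv₀M).support := notMem_support_takeUntil_support_takeUntil_subset hv₀u huM hv₀T
    refine build v₀ (W.append (K.M.takeUntil v₀ hv₀M)) ?_ ?_ hv₀
    · intro w hw
      rcases (Walk.mem_support_append_iff _ _).1 hw with hw | hw
      · exact hWsub w hw
      · exact Or.inr (Or.inl (support_takeUntil_subset_support _ _ hw))
    · intro hw
      rcases (Walk.mem_support_append_iff _ _).1 hw with hw | hw
      · exact huW hw
      · exact huT hw

end Dec

end CycleKit

end SubLoc

end Summit.CriticalPhenomena.PercolationContinuityZ3.Theorems.Transplant
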